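import Summits.CriticalPhenomena.PercolationContinuityZ3.Theorems.Transplant.SkelPhiFaceKitsOfNums9VC
import Summits.CriticalPhenomena.PercolationContinuityZ3.Theorems.Transplant.SkelPhiFaceRouteHrouteX6FVCQ
import Summits.CriticalPhenomena.PercolationContinuityZ3.Theorems.Transplant.SkelPhiFaceRouteHrouteY6FVCQ
import Summits.CriticalPhenomena.PercolationContinuityZ3.Theorems.Transplant.SkelPhiFaceKitsGFVCQ
import Summits.CriticalPhenomena.PercolationContinuityZ3.Theorems.Transplant.TwoAxisParaCellsFineFrameQ
import HarnessLib

/-!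
# WAVE-Q binder row «SkelPhiFaceKitsOfNums9VC» ↦ «SkelPhiFaceKitsOfNums9VCQ» (quasi-step rung (N3-b); captain gen-1 g4, WAVE-Q-BINDER-rows v0.7/v0.8, row Q59, FLOOR row; family stmt-g33 = «SkelPhiCorridor*» / «SkelPhiFace*»):
# **THE FACE-STEP KIT CLAUSES OF THE STAGGERED-CELL SCHEME FROM THE PER-CENTRE NUMBERS, UNDER EXACT-FOOTPRINT QUASI-STEPS** — `Skelφ.hkits_faceSteps_of_nums9VCQ`

builds on p205010 (kernel theorem, internal audit signed; external expert review pending) — nothing in this file uses p205010; nothing here is a claim about any open node (the quasi-step node's statement, name and wording are a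
lead's).  Lane `prim-bschramm`, seat `prim-bschramm-stmt` gen 33 (port pen).  Helper file (`--supports stmt-CriticalPhenomena-4575 --as helper`); def-free.  PORT RULES (captain #6109/#6122 hunk classes + R-1 = L-hp8-1 (b)): twin of the
one `hstep`-threading declaration of the tree module «SkelPhiFaceKitsOfNums9VC» (sha256 bc4ee1040784195e…, imported: its Steps-free lemmas are USED, not re-declared), statement and proof BYTE-IDENTICAL except: (i) `(hstep : Steps G φ)
↦ {Mq : ℕ} (hqφ : Skelφ.QStepsN G φ Mq)` (named `Mq`: the window half-width is `M`), with the frame-cost floors `hPNb : 1 ≤ Pb.N ↦ Mq ≤ Pb.N`, `hPNr : kq + 3 ≤ Pr.N ↦ Mq·(kq+3) ≤ Pr.N`, `hPN : 3 ≤ PA.N ↦ 3·Mq ≤ PA.N` (face frame, gen-1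
g4's `FinePrm.qStepsN_frame_q`); (ii) twins `pr.weakSteps_ψ hstep ↦ pr.weakSteps_ψ_q hqφ` («TwoAxisParaCellsFineFrameQ», gen-1 g4), `hroute_of_faceRunNums_x6FVC / y6FVC ↦ …Q` (Q56/Q57, this seat), `hkits_faceStepWNbFVC ↦ …Q` (Q46, this
seat); (iv) FLOOR tokens (p5-g28's pull list): `hπ1 ↦ Mq·‖B.core1Lo‖₁ ≤ r`; kit floors `KCmaxb ↦ Pb.N·KCmaxb`, `KCmaxr ↦ Pr.N·KCmaxr`, `KCmax ↦ PA.N·KCmax` in `hDw·` (all six run-window families), `hT'·`, `hr₀·`, `hrs·`, `hE·`,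
`hreach·`, `hMD`, and `KCmax· + 1 ↦ (KCmax·+1)·(P·.N+2)` in `hcS·`; and — LOCATED DESIGN ITEM L-stmt-1, OPTION (C) (bus 2026-08-27T09:24:31Z; refuter read p5-g28 09:25:46Z: sound, cheapest, floor rule PASS, no circularity because the
floors are over the providers' named choice functions) — THREE EXTRA HYPOTHESIS FAMILIES `hπMx / hπMy / hπMyx`, one per numbers binder `numsX / numsY / numsYx`, each the conjunction of the two run-length floors at quasi-step cost `Mq`
(x-shaped records: `RcL + Mq·((Nr+1)·shearUnit) ≤ r ∧ ∀ k ≤ N₃, RcT + Mq·col(k) ≤ r`; the Y4 record: `(∀ k ≤ Nr, RcL + Mq·col(k) ≤ r) ∧ RcT + Mq·((N₃+1)·shearUnit) ≤ r`, its along schedule reading `R's qB'`), fed to the Q56/Q57 twins'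
`hπ2M/hπ3M`; the records' `Mq`-free fields `hπ2/hπ3` are not read.  No landed file is edited or re-issued. Regression: `Mq = 1`, `P·.N`-tokens at `qStepsN_of_steps`, the three families `:= ⟨𝓝.hπ2, 𝓝.hπ3⟩` (after `one_mul`) give the
original.  Docstrings and citations are the original's.
-/

noncomputable section

open MeasureTheory ProbabilityTheory
open scoped ENNReal Classical

namespace Summit.CriticalPhenomena.PercolationContinuityZ3.Theorems.Transplant

namespace Skelφ

open Literature.Probability.Percolation Literature.Probability.LatticeModels SimpleGraph GadgetSystem Contour KNCells
open Literature.Probability.Percolation.KozmaNitzan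
open Literature.Probability.Percolation.KozmaNitzan.Cells (oth oth_ne sgOf sgOf_sign stepVec_apply_fst eq_oth_of_ne oth_oth)
open KNLevels ChainPlanar ChainPara
open Literature.Barriers.CriticalPhenomena (graphBall mem_graphBall_self graphBall_mono)
open BoxProdZ2 (ConcRadiiG Erad Frad nQ nS Realised Frad_succ Frad_le_Erad)
open Skel (winGraph routeW excess WinStepData)
open SkelI (tanOff)
open TwoAxis.Para (modulus detD)

variable {V : Type} [DecidableEq V] [Countable V] {G : SimpleGraph V} [G.LocallyFinite] {φ : V → Site 2}

/-- (WAVE-Q twin of `hkits_faceSteps_of_nums9VC` under `QStepsN G φ Mq`, L-stmt-1 option (C): three floor families `hπMx/hπMy/hπMyx` beside the numbers binders; `hπ1` ×`Mq`; kit floors ×`P·.N` per the header.) **THE `hkits` HYPOTHESIS OF `faceOblRM_fineNb2V` FROM THE KIT INPUTS AND THE PER-CENTRE NUMBERS** (see the module docstring).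
[cite: KozmaNitzan2024, §4 Lemma 10 (pp. 17–21), Lemma 12 (pp. 23–25), p. 30 (Step III)] -/
theorem hkits_faceSteps_of_nums9VCQ (hlipφ : Lip G φ) {Mq : ℕ} (hqφ : QStepsN G φ Mq)
    {Δg : ℕ} (hΔg : ∀ v, G.degree v ≤ Δg)
    -- the twin schemeO over the fine skeleton at `w₀`
    (pr : FinePrm) (w₀ : V) (P : PCells2V) (gap gap' : ℕ → ℕ) (E₀ L' : ℕ) (off : Site 2 → ℕ) (b₀ : Fin 2 → ℕ) (q : unitInterval) (δc : ℝ)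
    (hb₀ : ∀ i, b₀ i ≤ 3 * P.r i) (hc₀ : 0 < pr.c₀) (hc₁ : 0 < pr.c₁) (hDd : pr.D = detD pr.A pr.n pr.h pr.vα pr.vβ) (hD : 0 < pr.D)
    (hL0 : pr.c₀ * pr.L 0 + 2 ≤ pr.D) (hL1 : pr.c₁ * pr.L 1 + 2 ≤ pr.D) (hA0 : 0 < pr.A) {nL : ℕ} (hnL : 1 ≤ nL) (hvL : |pr.vα| ≤ nL)
    (hmf : 0 ≤ modulus nL pr.h pr.vα pr.vβ)
    (hgap : ∀ n, 1 ≤ gap n) (hE₀ : 2 ≤ E₀) (hL' : 1 ≤ L') {c : ℕ} {R₁' : ℕ → ℕ} (hgapR : ∀ ρ, c + 2 * L' + R₁' ρ + 2 ≤ gap ρ)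
    -- the face-frame data per direction
    (aw : MDir → ℕ) (Rlev N M : ℕ) {k₀ : ℤ} {kF : Fin 2 → ℤ} (hk₀ : ∀ I, pr.rdN I (pr.bOf I) ≤ pr.rdK I (pr.bOf I) * k₀)
    (hk₀' : ∀ i, 3 * (P.r i : ℤ) + k₀ + 3 ≤ 5 * P.r i)
    (hRlev : ∀ i, Rlev + 4 ≤ 10 * P.s i) (hRlev' : ∀ du : MDir, (Rlev : ℤ) + 5 + P.c du.1 ≤ 3 * P.r (oth du.1))
    (hroomF : ∀ du : MDir,
      pr.Mabs * (aw du + Rlev + 1) + pr.rdN du.1 (pr.bOf du.1) * (Rlev + 2) * pr.D ≤ pr.rdK du.1 (pr.bOf du.1) * kF du.1 * pr.D)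
    (hkF : ∀ I, kF I + 3 + P.c I + P.r (oth I) ≤ 5 * (P.r (oth I) : ℤ)) {nF : Fin 2 → ℕ} (hnC : ∀ I, (nF I : ℤ) ≤ pr.cOf I * |pr.A| * |pr.lvGen I (pr.bOf I)|)
    (hU3 : ∀ I, pr.D ≤ 3 * (nF I : ℤ)) {E r : ℕ} {δ₂ : ℝ} (hδ₂ : 0 < δ₂)
    -- THE ROUTE BLOCK (c-uniform; all signs)
    (B : BridgePrm) (hB : BridgeOK B)
    {kq : ℕ} (hκL : pr.h.natAbs ≤ kq * nL) (ℓ' R's qB Rl R'₃ qB₃ qB' qB₃' : ℕ)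
    (hlay : (nL + pr.h.natAbs : ℕ) ≤ (nL : ℤ) * ℓ' + 1)
    (Rlev₁ N₁ j₀₁ j₁₁ Rlev₂ N₂ j₀₂ j₁₂ Rlev₃ N₃' j₀₃ j₁₃ : ℕ) (hRl₁ : Rlev₁ + 1 ≤ B.R') (hRl₂ : Rlev₂ + 1 ≤ R's) (hRl₃ : Rlev₃ + 1 ≤ R'₃)
    (hj₁ : j₁₁ ≤ Rlev₁) (hj₂ : j₁₂ ≤ Rlev₂) (hj₃ : j₁₃ ≤ Rlev₃)
    (hB0 : Finset.Icc (pt nL (1 * pr.h)) (pt nL (1 * pr.h + ℓ')) ⊆ Finset.Icc B.B₀lo B.B₀hi) (hRlr : Rl ≤ r)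
    -- the near-`c` block READ BY THE TWO LATTICE FUNCTIONALS (L-F2): bridge regions (every frame sign), hop prism, zone box, fine extents `kA`
    {Λ₀ Λ₁ : ℤ} {kA : Fin 2 → ℤ}
    (hΛR : ∀ x ∈ Finset.Icc B.regionLo B.regionHi, |pr.vβ * (1 * x 0) - pr.vα * x 1| ≤ Λ₀ ∧ |(nL : ℤ) * x 1 - pr.h * (1 * x 0)| ≤ Λ₁)
    (hΛQ0 : modulus nL pr.h pr.vα pr.vβ + (nL : ℤ) * ((3 * ℓ' : ℕ) : ℤ) ≤ Λ₀) (hΛQ1 : (nL : ℤ) * ((3 * ℓ' : ℕ) : ℤ) ≤ Λ₁) {Mz : ℕ}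
    (hΛZ : (|pr.vβ| + |pr.vα|) * (Mz : ℤ) ≤ Λ₀ ∧ ((nL : ℤ) + |pr.h|) * (Mz : ℤ) ≤ Λ₁)
    (hkA0 : pr.c₀ * (|pr.A| * Λ₀) ≤ kA 0 * pr.D) (hkA1 : pr.c₁ * (|pr.A| * Λ₁) ≤ kA 1 * pr.D)
    {kb : ℕ} (hkbMz : (Mz : ℤ) ≤ kb) (hπ1 : Mq * ((B.core1Lo 0).natAbs + (B.core1Lo 1).natAbs) ≤ r)
    (hclr₁ : (kb : ℤ) < B.B₀lo 0 - B.R' - B.pr)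
    {Δ' : ℕ} {δ η : ℝ} (hδ : 0 < δ) (hδ1 : δ ≤ 1) (nF : ℕ)
    -- the inner-chain fact UP TO THE LENGTH BUDGET `nF` (p3-g11 2026-08-22T02:23:54Z; the wrapper discharges it by `ChainFactF` at `n ≤ LfA K₀`)
    (hchain : ∀ (c : V) (Nr N₃ : ℕ), 0 + 1 + Nr + 1 + N₃ ≤ nF → ∀ (W : Sym2 V → unitInterval) (s : Fin (0 + 1 + Nr + 1 + N₃ + 1) → TStep (winGraph G c r))
      (T' : Fin (0 + 1 + Nr + 1 + N₃ + 1) → Finset V) (η : ℝ),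
      (∀ i, (s i).L.o = (s 0).L.o) →
      (∀ i : Fin (0 + 1 + Nr + 1 + N₃), T' (Fin.castSucc i) ⊆ (s i.succ).L.X 0) →
      (∀ i, T' i ⊆ (s i).T) →
      (∀ i, (s i).KitsAtF W q Δ' δ) →
      η ≤ δ / 2 →
      (∀ i, (prodBernoulli W).real (⋃ t ∈ (s i).T \ T' i, openConn (s 0).L.o t) ≤ η) →
      1 - δ < (prodBernoulli W).real (s 0).L.reachB →
        1 - δ₂ ^ 3 < (prodBernoulli W).real (⋃ t ∈ T' (Fin.last (0 + 1 + Nr + 1 + N₃)), openConn (s 0).L.o t))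
    (hcount₁ : 1 / (1 - (q : ℝ)) ^ (Δ' * N₁) ≤ δ * ((Finset.Icc j₀₁ j₁₁).card : ℝ))
    (hcount₂ : 1 / (1 - (q : ℝ)) ^ (Δ' * N₂) ≤ δ * ((Finset.Icc j₀₂ j₁₂).card : ℝ))
    (hcount₃ : 1 / (1 - (q : ℝ)) ^ (Δ' * N₃') ≤ δ * ((Finset.Icc j₀₃ j₁₃).card : ℝ))
    (hη : η ≤ δ / 2)
    (Pb Pr : ApronPrm) {Rs KCmaxb KCmaxr rsb rsr cSb cSr cU r₁ r₂ Rb : ℕ}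
    (hPNb : Mq ≤ Pb.N) (hAb : Pb.A = (Mz : ℤ) + 2)
    (hdDb : Pb.d + 2 ≤ shellD Pb) (hDρb : Rs + 1 ≤ shellD Pb) (hKCmaxb : shellD Pb + Mz + 1 ≤ KCmaxb)
    (hwideb : ∀ j, j₀₁ ≤ j → j ≤ j₁₁ → ∀ i, (B.B₀lo - (j : Site 2)) i + 2 * tanOff Pb.ℓs Pb.M ≤ (B.B₀hi + (j : Site 2)) i)
    (hdwb : ∀ j, j₀₁ ≤ j → j ≤ j₁₁ → ∀ i, (B.B₀lo - (j : Site 2)) i + (Pb.d + 2 : ℕ) ≤ (B.B₀hi + (j : Site 2)) i)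
    (hDwb : ∀ j, j₀₁ ≤ j → j ≤ j₁₁ → ∀ i, (B.B₀lo - (j : Site 2)) i + ((shellD Pb + 1 + Pb.d + Pb.N * KCmaxb + Rs : ℕ) : ℤ) ≤ (B.B₀hi + (j : Site 2)) i)
    (hT'b : (shellD Pb : ℤ) + Pb.N * KCmaxb + Rs ≤ tanOff Pb.ℓs Pb.M)
    (hr₀b : Pb.N * (tanOff Pb.ℓs Pb.M + 2) + Pb.N * Pb.d + (Pb.N * KCmaxb + Rs) ≤ Pb.r₀) (hRb₀ : Pb.r₀ ≤ r)
    (hrsb : 1 + (Pb.N * (tanOff Pb.ℓs Pb.M + 2) + Pb.N * Pb.d + (Pb.N * KCmaxb + Rs)) ≤ rsb)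
    (hcSb : (Pb.N + 1) * (tanOff Pb.ℓs Pb.M + 1) + (Pb.N + 1) * Pb.d + (KCmaxb + 1) * (Pb.N + 2) + cU ≤ cSb)
    (hEb : j₁₁ + (Pb.N * (tanOff Pb.ℓs Pb.M + 1) + Pb.N * Pb.d + Pb.N * KCmaxb) ≤ B.R')
    (hreachb : r₁ + (Pb.N * (tanOff Pb.ℓs Pb.M + 1) + Pb.N * Pb.d + Pb.N * KCmaxb) ≤ Pb.r₀) (hr₁ : Rb ≤ r₁) (hr₁R : r₁ ≤ r)
    (hPNr : Mq * (kq + 3) ≤ Pr.N) (hAr : Pr.A = (Mz + 1 : ℕ) * (shearUnit nL pr.h : ℤ) + 1)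
    (hdDr : Pr.d + 2 ≤ shellD Pr) (hDρr : Rs + 1 ≤ shellD Pr) (hKCmaxr : (shellD Pr + Mz + 1) * (kq + 1) ≤ KCmaxr)
    (hwider : ∀ Nr, ∀ k ≤ Nr, ∀ j, j₀₂ ≤ j → j ≤ j₁₂ → ∀ i, ((xRunSched nL ℓ' pr.h R's qB Nr).lo k - (j : Site 2)) i + 2 * tanOff Pr.ℓs Pr.M ≤
      ((xRunSched nL ℓ' pr.h R's qB Nr).hi k + (j : Site 2)) i)
    (hdwr : ∀ Nr, ∀ k ≤ Nr, ∀ j, j₀₂ ≤ j → j ≤ j₁₂ → ∀ i, ((xRunSched nL ℓ' pr.h R's qB Nr).lo k - (j : Site 2)) i + (Pr.d + 2 : ℕ) ≤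
      ((xRunSched nL ℓ' pr.h R's qB Nr).hi k + (j : Site 2)) i)
    (hDwr : ∀ Nr, ∀ k ≤ Nr, ∀ j, j₀₂ ≤ j → j ≤ j₁₂ → ∀ i, ((xRunSched nL ℓ' pr.h R's qB Nr).lo k - (j : Site 2)) i + ((shellD Pr + 1 + Pr.d + Pr.N * KCmaxr + Rs : ℕ) : ℤ) ≤
      ((xRunSched nL ℓ' pr.h R's qB Nr).hi k + (j : Site 2)) i)
    (hwidey : ∀ N₃, ∀ k ≤ N₃, ∀ j, j₀₃ ≤ j → j ≤ j₁₃ → ∀ i, ((yRunSched hnL hvL hlay R'₃ qB₃ N₃).lo k - (j : Site 2)) i + 2 * tanOff Pr.ℓs Pr.M ≤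
      ((yRunSched hnL hvL hlay R'₃ qB₃ N₃).hi k + (j : Site 2)) i)
    (hdwy : ∀ N₃, ∀ k ≤ N₃, ∀ j, j₀₃ ≤ j → j ≤ j₁₃ → ∀ i, ((yRunSched hnL hvL hlay R'₃ qB₃ N₃).lo k - (j : Site 2)) i + (Pr.d + 2 : ℕ) ≤
      ((yRunSched hnL hvL hlay R'₃ qB₃ N₃).hi k + (j : Site 2)) i)
    (hDwy : ∀ N₃, ∀ k ≤ N₃, ∀ j, j₀₃ ≤ j → j ≤ j₁₃ → ∀ i, ((yRunSched hnL hvL hlay R'₃ qB₃ N₃).lo k - (j : Site 2)) i + ((shellD Pr + 1 + Pr.d + Pr.N * KCmaxr + Rs : ℕ) : ℤ) ≤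
      ((yRunSched hnL hvL hlay R'₃ qB₃ N₃).hi k + (j : Site 2)) i)
    (hwiderY : ∀ Nr, ∀ k ≤ Nr, ∀ j, j₀₂ ≤ j → j ≤ j₁₂ → ∀ i, ((yRunSched hnL hvL hlay R's qB' Nr).lo k - (j : Site 2)) i + 2 * tanOff Pr.ℓs Pr.M ≤
      ((yRunSched hnL hvL hlay R's qB' Nr).hi k + (j : Site 2)) i)
    (hdwrY : ∀ Nr, ∀ k ≤ Nr, ∀ j, j₀₂ ≤ j → j ≤ j₁₂ → ∀ i, ((yRunSched hnL hvL hlay R's qB' Nr).lo k - (j : Site 2)) i + (Pr.d + 2 : ℕ) ≤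
      ((yRunSched hnL hvL hlay R's qB' Nr).hi k + (j : Site 2)) i)
    (hDwrY : ∀ Nr, ∀ k ≤ Nr, ∀ j, j₀₂ ≤ j → j ≤ j₁₂ → ∀ i, ((yRunSched hnL hvL hlay R's qB' Nr).lo k - (j : Site 2)) i + ((shellD Pr + 1 + Pr.d + Pr.N * KCmaxr + Rs : ℕ) : ℤ) ≤
      ((yRunSched hnL hvL hlay R's qB' Nr).hi k + (j : Site 2)) i)
    (hwideyY : ∀ N₃, ∀ k ≤ N₃, ∀ j, j₀₃ ≤ j → j ≤ j₁₃ → ∀ i, ((xRunSched nL ℓ' pr.h R'₃ qB₃' N₃).lo k - (j : Site 2)) i + 2 * tanOff Pr.ℓs Pr.M ≤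
      ((xRunSched nL ℓ' pr.h R'₃ qB₃' N₃).hi k + (j : Site 2)) i)
    (hdwyY : ∀ N₃, ∀ k ≤ N₃, ∀ j, j₀₃ ≤ j → j ≤ j₁₃ → ∀ i, ((xRunSched nL ℓ' pr.h R'₃ qB₃' N₃).lo k - (j : Site 2)) i + (Pr.d + 2 : ℕ) ≤
      ((xRunSched nL ℓ' pr.h R'₃ qB₃' N₃).hi k + (j : Site 2)) i)
    (hDwyY : ∀ N₃, ∀ k ≤ N₃, ∀ j, j₀₃ ≤ j → j ≤ j₁₃ → ∀ i, ((xRunSched nL ℓ' pr.h R'₃ qB₃' N₃).lo k - (j : Site 2)) i + ((shellD Pr + 1 + Pr.d + Pr.N * KCmaxr + Rs : ℕ) : ℤ) ≤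
      ((xRunSched nL ℓ' pr.h R'₃ qB₃' N₃).hi k + (j : Site 2)) i)
    (hT'r : (shellD Pr : ℤ) + Pr.N * KCmaxr + Rs ≤ tanOff Pr.ℓs Pr.M)
    (hr₀r : Pr.N * (tanOff Pr.ℓs Pr.M + 2) + Pr.N * Pr.d + (Pr.N * KCmaxr + Rs) ≤ Pr.r₀) (hRr₀ : Pr.r₀ ≤ r)
    (hrsr : 1 + (Pr.N * (tanOff Pr.ℓs Pr.M + 2) + Pr.N * Pr.d + (Pr.N * KCmaxr + Rs)) ≤ rsr)
    (hcSr : (Pr.N + 1) * (tanOff Pr.ℓs Pr.M + 1) + (Pr.N + 1) * Pr.d + (KCmaxr + 1) * (Pr.N + 2) + cU ≤ cSr)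
    (hEr : j₁₂ + (Pr.N * (tanOff Pr.ℓs Pr.M + 1) + Pr.N * Pr.d + Pr.N * KCmaxr) ≤ R's)
    (hEy : j₁₃ + (Pr.N * (tanOff Pr.ℓs Pr.M + 1) + Pr.N * Pr.d + Pr.N * KCmaxr) ≤ R'₃)
    (hreachr : r₂ + (Pr.N * (tanOff Pr.ℓs Pr.M + 1) + Pr.N * Pr.d + Pr.N * KCmaxr) ≤ Pr.r₀) (hr₂ : Rl ≤ r₂) (hr₂R : r₂ ≤ r)
    -- the short region and the zone datum at the kit centres ((S0): inside `Rg`, connected, containing the centre and the fat-prism box `cylBallFin c kz Rk`)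
    (Rg : V → Finset V) (hRg : ∀ c', ∀ u ∈ Rg c', u ∈ graphBall G c' Rs) (hRgcard : ∀ c', (Rg c').card ≤ cU) (hcU1 : 1 ≤ cU)
    (Λc : V → ℕ → Finset V) (kz : ℕ) (hΛ : ∀ c', ∀ v ∈ Λc c' kz, v ∈ Rg c' ∧ φ v - φ c' ∈ box 2 Mz) (hclrz : (Mz + 4) * (nL + pr.h.natAbs) ≤ nL * (ℓ' + 1))
    (hcz : ∀ c, c ∈ Λc c kz) (hzconn : ∀ c, ∀ s ∈ Λc c kz, PathIn G (↑(Λc c kz) : Set V) c s) (hRsr : Rs ≤ r)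


    {ρZ : ℕ} (hZρ : ∀ c', ∀ s ∈ Λc c' kz, s ∈ graphBall G c' ρZ) (hρr : ρZ ≤ r)
    (hZU : ∀ c, Λc c kz ⊆ pgramPrismFin G φ c nL pr.h (3 * ℓ') Rl)
    (Qb Fb : V → Finset V)
    (hQb : ∀ c c', ∀ w ∈ Qb c', w ∈ graphBall G c' Rb ∧
      rootFrame φ c 1 w ∈ Finset.Icc (rootFrame φ c 1 c' - ((B.pr : ℕ) : Site 2)) (rootFrame φ c 1 c' + ((B.pr : ℕ) : Site 2)))
    (hFb : ∀ c c', ∀ w ∈ Fb c', w ∈ Qb c' ∧ rootFrame φ c 1 w ∈ Finset.Icc (rootFrame φ c 1 c' + B.dlo) (rootFrame φ c 1 c' + B.dhi))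
    (kk₁ kk₂ kk₃ : ℕ) (hkN₁ : kk₁ * (Δg + 1) ^ (2 * rsb) ≤ N₁) (hkN₂ : kk₂ * (Δg + 1) ^ (2 * rsr) ≤ N₂) (hkN₃ : kk₃ * (Δg + 1) ^ (2 * rsr) ≤ N₃')
    (hk₁ : (1 - (q : ℝ) ^ (1 + Δg * cSb + cSb * cU)) ^ kk₁ ≤ δ) (hk₂ : (1 - (q : ℝ) ^ (1 + Δg * cSr + cSr * cU)) ^ kk₂ ≤ δ)
    (hk₃ : (1 - (q : ℝ) ^ (1 + Δg * cSr + cSr * cU)) ^ kk₃ ≤ δ)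
    (hbridge : ∀ c', 1 - δ ^ 3 < (bondPercolation G q).real (linkIn (↑(Qb c') : Set V) (Λc c' kz) (Fb c')))
    (hlongx : ∀ c' (τ : ℤ), τ = 1 ∨ τ = -1 → 1 - δ ^ 3 < (bondPercolation G q).real
      (linkIn (pgramPrism G φ c' nL pr.h (3 * ℓ') Rl) (Λc c' kz) (pgSideHalfW G φ c' nL pr.h ℓ' Rl 1 (1 * τ))))
    (hlongy : ∀ c' (τ : ℤ), τ = 1 ∨ τ = -1 → 1 - δ ^ 3 < (bondPercolation G q).real
      (linkIn (pgramPrism G φ c' nL pr.h (3 * ℓ') Rl) (Λc c' kz) (pgTopPieceW G φ c' nL pr.h ℓ' Rl 1 τ pr.vα)))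
    -- the planar diameter of the face regions (fineNb2's `hdiam`): it bounds the kit worlds too
    {m : ℕ} (hdiam : ∀ b' : Fin 2, (pr.rdK 1 b' + pr.rdK 0 b') * ((50 * P.rmax : ℕ) + 1) * pr.D ≤ pr.Mabs * (m + 1))
    {R₁ : ℕ}
    (hR₁ : ∀ (c' : V) (R' : ℕ), R₁ ≤ R' → ∀ (Rw : ℕ) (D' B' : Finset V), (∀ d ∈ D', d ∈ graphBall G c' Rw) →
      (∀ d ∈ D', ∀ d' ∈ D', φ d - φ d' ∈ box 2 m) → B' ⊆ D' → (∀ a ∈ B', a ∈ graphBall G c' ρZ) →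
        (bondPercolation G q).real (excess G c' R' D' B') ≤ η)
    (hR₁b : R₁ ≤ r - Pb.r₀) (hR₁r : R₁ ≤ r - Pr.r₀)
    -- the FACE KIT: constants, exit table rooms, reach, inputs at accuracy `δ₂`
    (PA : ApronPrm) {nz KCmax rs cS : ℕ} (hPN : 3 * Mq ≤ PA.N) (hA : PA.A = (nz + 1 : ℕ) * pr.D + 1)
    (hdD : PA.d + 2 ≤ shellD PA) (hDρ : Rs + 1 ≤ shellD PA) (hKCmax : (shellD PA + nz + 1) * 3 ≤ KCmax)
    (hMtan : tanOff PA.ℓs PA.M ≤ (M : ℤ) + 1) (hMd : PA.d + 2 ≤ 2 * M + 2) (hMD : shellD PA + 1 + PA.d + PA.N * KCmax + Rs ≤ 2 * M + 2)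
    (hT' : (shellD PA : ℤ) + PA.N * KCmax + Rs ≤ tanOff PA.ℓs PA.M)
    (hr₀ : PA.N * (tanOff PA.ℓs PA.M + 2) + PA.N * PA.d + (PA.N * KCmax + Rs) ≤ PA.r₀) (hr₀L : PA.r₀ + 1 ≤ 2 * L')
    (hrs : 1 + (PA.N * (tanOff PA.ℓs PA.M + 2) + PA.N * PA.d + (PA.N * KCmax + Rs)) ≤ rs)
    (hcS : (PA.N + 1) * (tanOff PA.ℓs PA.M + 1) + (PA.N + 1) * PA.d + (KCmax + 1) * (PA.N + 2) + cU ≤ cS)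
    (hE : Rlev + (PA.N * (tanOff PA.ℓs PA.M + 1) + PA.N * PA.d + PA.N * KCmax) ≤ E)
    (hreach : r + (PA.N * (tanOff PA.ℓs PA.M + 1) + PA.N * PA.d + PA.N * KCmax) ≤ PA.r₀)

    (kk : ℕ) (hN : kk * (Δg + 1) ^ (2 * rs) ≤ N) (hk : (1 - (q : ℝ) ^ (1 + Δg * cS + cS * cU)) ^ kk ≤ δ₂)
    -- THE PER-CENTRE NUMBERS (x-faces `du.1 = 0`, y′-faces `du.1 = 1`)
    (yx : Bool)
    (numsX : ∀ (a' : ℕ) (x : Site 2) (du : MDir) (j : ℕ) (pc : ℤ) (c' : V), du.1 = 0 → du.2 = true → j < P.K → ∀ yF : V,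
      pr.ψ φ w₀ yF = P.faceCen x du j → pc = relφ φ w₀ yF (pr.bOf du.1) →
      pr.frame φ w₀ du.1 (pr.bOf du.1) c' ∈ Finset.Icc (loNV P x du j pc (aw du) - ((E : ℕ) : Site 2)) (hiNV P x du j pc (aw du) + ((E : ℕ) : Site 2)) →
      c' ∈ graphBall G w₀ ((concRadii2N P.toPCells2 gap gap' E₀ L' off).rE a' x du - r) →
      L' ≤ (concRadii2N P.toPCells2 gap gap' E₀ L' off).rM a' (x + stepVec du) → r ≤ (concRadii2N P.toPCells2 gap gap' E₀ L' off).rE a' x du →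
      FaceRunNumsX4 G φ (pr.ψ φ w₀) c' pr.A nL pr.h pr.vα pr.vβ pr.c₀ pr.c₁ pr.D du (sgOf du) B ℓ' R's qB R'₃ qB₃ pr.vα hnL hvL hlay Mz
        (P.farCore x du j k₀) (targetMMV G φ pr P w₀ (concRadii2N P.toPCells2 gap gap' E₀ L' off) b₀ a' x du L') (Λc c' Mz) r (kA du.1) (kA (oth du.1)))
    (numsY : ∀ (a' : ℕ) (x : Site 2) (du : MDir) (j : ℕ) (pc : ℤ) (c' : V), du.1 = 1 → yx = false → du.2 = true → j < P.K → ∀ yF : V,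
      pr.ψ φ w₀ yF = P.faceCen x du j → pc = relφ φ w₀ yF (pr.bOf du.1) →
      pr.frame φ w₀ du.1 (pr.bOf du.1) c' ∈ Finset.Icc (loNV P x du j pc (aw du) - ((E : ℕ) : Site 2)) (hiNV P x du j pc (aw du) + ((E : ℕ) : Site 2)) →
      c' ∈ graphBall G w₀ ((concRadii2N P.toPCells2 gap gap' E₀ L' off).rE a' x du - r) →
      L' ≤ (concRadii2N P.toPCells2 gap gap' E₀ L' off).rM a' (x + stepVec du) → r ≤ (concRadii2N P.toPCells2 gap gap' E₀ L' off).rE a' x du →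
      FaceRunNumsY4 G φ (pr.ψ φ w₀) c' pr.A nL pr.h pr.vα pr.vβ pr.c₀ pr.c₁ pr.D du 1 (sgOf du) B ℓ' R's qB' R'₃ qB₃' pr.vα hnL hvL
        hlay Mz (P.farCore x du j k₀) (targetMMV G φ pr P w₀ (concRadii2N P.toPCells2 gap gap' E₀ L' off) b₀ a' x du L') (Λc c' Mz) r (kA du.1) (kA (oth du.1)))
    (numsYx : ∀ (a' : ℕ) (x : Site 2) (du : MDir) (j : ℕ) (pc : ℤ) (c' : V), du.1 = 1 → yx = true → du.2 = true → j < P.K → ∀ yF : V,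
      pr.ψ φ w₀ yF = P.faceCen x du j → pc = relφ φ w₀ yF (pr.bOf du.1) →
      pr.frame φ w₀ du.1 (pr.bOf du.1) c' ∈ Finset.Icc (loNV P x du j pc (aw du) - ((E : ℕ) : Site 2)) (hiNV P x du j pc (aw du) + ((E : ℕ) : Site 2)) →
      c' ∈ graphBall G w₀ ((concRadii2N P.toPCells2 gap gap' E₀ L' off).rE a' x du - r) →
      L' ≤ (concRadii2N P.toPCells2 gap gap' E₀ L' off).rM a' (x + stepVec du) → r ≤ (concRadii2N P.toPCells2 gap gap' E₀ L' off).rE a' x du →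
      FaceRunNumsX4 G φ (pr.ψ φ w₀) c' pr.A nL pr.h pr.vα pr.vβ pr.c₀ pr.c₁ pr.D du (sgOf du) B ℓ' R's qB R'₃ qB₃ pr.vα hnL hvL hlay Mz
        (P.farCore x du j k₀) (targetMMV G φ pr P w₀ (concRadii2N P.toPCells2 gap gap' E₀ L' off) b₀ a' x du L') (Λc c' Mz) r (kA du.1) (kA (oth du.1)))
    -- the providers' stride counts within the budget
    (hnFx : ∀ (a' : ℕ) (x : Site 2) (du : MDir) (j : ℕ) (pc : ℤ) (c' : V) (hI : du.1 = 0) (hs : du.2 = true) (hj : j < P.K) (yF : V)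
      (hyF : pr.ψ φ w₀ yF = P.faceCen x du j) (hpc : pc = relφ φ w₀ yF (pr.bOf du.1))
      (h1 : pr.frame φ w₀ du.1 (pr.bOf du.1) c' ∈ Finset.Icc (loNV P x du j pc (aw du) - ((E : ℕ) : Site 2)) (hiNV P x du j pc (aw du) + ((E : ℕ) : Site 2)))
      (h2 : c' ∈ graphBall G w₀ ((concRadii2N P.toPCells2 gap gap' E₀ L' off).rE a' x du - r))
      (hM : L' ≤ (concRadii2N P.toPCells2 gap gap' E₀ L' off).rM a' (x + stepVec du)) (hE : r ≤ (concRadii2N P.toPCells2 gap gap' E₀ L' off).rE a' x du),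
      0 + 1 + (numsX a' x du j pc c' hI hs hj yF hyF hpc h1 h2 hM hE).Nr + 1 + (numsX a' x du j pc c' hI hs hj yF hyF hpc h1 h2 hM hE).N₃ ≤ nF)
    (hnFy : ∀ (a' : ℕ) (x : Site 2) (du : MDir) (j : ℕ) (pc : ℤ) (c' : V) (hI : du.1 = 1) (hyx : yx = false) (hs : du.2 = true) (hj : j < P.K) (yF : V)
      (hyF : pr.ψ φ w₀ yF = P.faceCen x du j) (hpc : pc = relφ φ w₀ yF (pr.bOf du.1))
      (h1 : pr.frame φ w₀ du.1 (pr.bOf du.1) c' ∈ Finset.Icc (loNV P x du j pc (aw du) - ((E : ℕ) : Site 2)) (hiNV P x du j pc (aw du) + ((E : ℕ) : Site 2)))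
      (h2 : c' ∈ graphBall G w₀ ((concRadii2N P.toPCells2 gap gap' E₀ L' off).rE a' x du - r))
      (hM : L' ≤ (concRadii2N P.toPCells2 gap gap' E₀ L' off).rM a' (x + stepVec du)) (hE : r ≤ (concRadii2N P.toPCells2 gap gap' E₀ L' off).rE a' x du),
      0 + 1 + (numsY a' x du j pc c' hI hyx hs hj yF hyF hpc h1 h2 hM hE).Nr + 1 + (numsY a' x du j pc c' hI hyx hs hj yF hyF hpc h1 h2 hM hE).N₃ ≤ nF)
    (hnFyx : ∀ (a' : ℕ) (x : Site 2) (du : MDir) (j : ℕ) (pc : ℤ) (c' : V) (hI : du.1 = 1) (hyx : yx = true) (hs : du.2 = true) (hj : j < P.K) (yF : V)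
      (hyF : pr.ψ φ w₀ yF = P.faceCen x du j) (hpc : pc = relφ φ w₀ yF (pr.bOf du.1))
      (h1 : pr.frame φ w₀ du.1 (pr.bOf du.1) c' ∈ Finset.Icc (loNV P x du j pc (aw du) - ((E : ℕ) : Site 2)) (hiNV P x du j pc (aw du) + ((E : ℕ) : Site 2)))
      (h2 : c' ∈ graphBall G w₀ ((concRadii2N P.toPCells2 gap gap' E₀ L' off).rE a' x du - r))
      (hM : L' ≤ (concRadii2N P.toPCells2 gap gap' E₀ L' off).rM a' (x + stepVec du)) (hE : r ≤ (concRadii2N P.toPCells2 gap gap' E₀ L' off).rE a' x du),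
      0 + 1 + (numsYx a' x du j pc c' hI hyx hs hj yF hyF hpc h1 h2 hM hE).Nr + 1 + (numsYx a' x du j pc c' hI hyx hs hj yF hyF hpc h1 h2 hM hE).N₃ ≤ nF)
    -- ONE-SIDED ((R-44)(c)): the numbers' tangential sign is the served sign `1` (one-sided counts `KS.N3WX/N3WY`)
    (hσTx : ∀ (a' : ℕ) (x : Site 2) (du : MDir) (j : ℕ) (pc : ℤ) (c' : V) (hI : du.1 = 0) (hs : du.2 = true) (hj : j < P.K) (yF : V)
      (hyF : pr.ψ φ w₀ yF = P.faceCen x du j) (hpc : pc = relφ φ w₀ yF (pr.bOf du.1))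
      (h1 : pr.frame φ w₀ du.1 (pr.bOf du.1) c' ∈ Finset.Icc (loNV P x du j pc (aw du) - ((E : ℕ) : Site 2)) (hiNV P x du j pc (aw du) + ((E : ℕ) : Site 2)))
      (h2 : c' ∈ graphBall G w₀ ((concRadii2N P.toPCells2 gap gap' E₀ L' off).rE a' x du - r))
      (hM : L' ≤ (concRadii2N P.toPCells2 gap gap' E₀ L' off).rM a' (x + stepVec du)) (hE : r ≤ (concRadii2N P.toPCells2 gap gap' E₀ L' off).rE a' x du),
      (numsX a' x du j pc c' hI hs hj yF hyF hpc h1 h2 hM hE).σT = 1)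
    (hσTy : ∀ (a' : ℕ) (x : Site 2) (du : MDir) (j : ℕ) (pc : ℤ) (c' : V) (hI : du.1 = 1) (hyx : yx = false) (hs : du.2 = true) (hj : j < P.K) (yF : V)
      (hyF : pr.ψ φ w₀ yF = P.faceCen x du j) (hpc : pc = relφ φ w₀ yF (pr.bOf du.1))
      (h1 : pr.frame φ w₀ du.1 (pr.bOf du.1) c' ∈ Finset.Icc (loNV P x du j pc (aw du) - ((E : ℕ) : Site 2)) (hiNV P x du j pc (aw du) + ((E : ℕ) : Site 2)))
      (h2 : c' ∈ graphBall G w₀ ((concRadii2N P.toPCells2 gap gap' E₀ L' off).rE a' x du - r))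
      (hM : L' ≤ (concRadii2N P.toPCells2 gap gap' E₀ L' off).rM a' (x + stepVec du)) (hE : r ≤ (concRadii2N P.toPCells2 gap gap' E₀ L' off).rE a' x du),
      (numsY a' x du j pc c' hI hyx hs hj yF hyF hpc h1 h2 hM hE).σT = 1)
    (hσTyx : ∀ (a' : ℕ) (x : Site 2) (du : MDir) (j : ℕ) (pc : ℤ) (c' : V) (hI : du.1 = 1) (hyx : yx = true) (hs : du.2 = true) (hj : j < P.K) (yF : V)
      (hyF : pr.ψ φ w₀ yF = P.faceCen x du j) (hpc : pc = relφ φ w₀ yF (pr.bOf du.1))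
      (h1 : pr.frame φ w₀ du.1 (pr.bOf du.1) c' ∈ Finset.Icc (loNV P x du j pc (aw du) - ((E : ℕ) : Site 2)) (hiNV P x du j pc (aw du) + ((E : ℕ) : Site 2)))
      (h2 : c' ∈ graphBall G w₀ ((concRadii2N P.toPCells2 gap gap' E₀ L' off).rE a' x du - r))
      (hM : L' ≤ (concRadii2N P.toPCells2 gap gap' E₀ L' off).rM a' (x + stepVec du)) (hE : r ≤ (concRadii2N P.toPCells2 gap gap' E₀ L' off).rE a' x du),
      (numsYx a' x du j pc c' hI hyx hs hj yF hyF hpc h1 h2 hM hE).σT = 1)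
    -- (WAVE-Q, L-stmt-1 option (C); p5-g28 09:25:46Z) THE RUN-LENGTH FLOORS AT QUASI-STEP COST `Mq` of the three numbers binders (lower bounds on the face radius `r` over the
    -- providers' `RcL/RcT/Nr/N₃` — at the providers Q16/Q17/Q24 the named choice functions; the records' `Mq`-free fields `hπ2/hπ3` are not read)
    (hπMx : ∀ (a' : ℕ) (x : Site 2) (du : MDir) (j : ℕ) (pc : ℤ) (c' : V) (hI : du.1 = 0) (hs : du.2 = true) (hj : j < P.K) (yF : V)
      (hyF : pr.ψ φ w₀ yF = P.faceCen x du j) (hpc : pc = relφ φ w₀ yF (pr.bOf du.1))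
      (h1 : pr.frame φ w₀ du.1 (pr.bOf du.1) c' ∈ Finset.Icc (loNV P x du j pc (aw du) - ((E : ℕ) : Site 2)) (hiNV P x du j pc (aw du) + ((E : ℕ) : Site 2)))
      (h2 : c' ∈ graphBall G w₀ ((concRadii2N P.toPCells2 gap gap' E₀ L' off).rE a' x du - r))
      (hM : L' ≤ (concRadii2N P.toPCells2 gap gap' E₀ L' off).rM a' (x + stepVec du)) (hE : r ≤ (concRadii2N P.toPCells2 gap gap' E₀ L' off).rE a' x du),
      (numsX a' x du j pc c' hI hs hj yF hyF hpc h1 h2 hM hE).RcL + Mq * (((numsX a' x du j pc c' hI hs hj yF hyF hpc h1 h2 hM hE).Nr + 1) * shearUnit nL pr.h) ≤ r ∧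
      ∀ k ≤ (numsX a' x du j pc c' hI hs hj yF hyF hpc h1 h2 hM hE).N₃, (numsX a' x du j pc c' hI hs hj yF hyF hpc h1 h2 hM hE).RcT + Mq * (((((k + 1 : ℕ) : ℤ) * pr.vα).natAbs +
        (((shearUnit nL pr.h : ℤ) * |((k + 1 : ℕ) : ℤ) * (yPrmW nL ℓ' pr.h pr.vα R'₃ qB₃ (numsX a' x du j pc c' hI hs hj yF hyF hpc h1 h2 hM hE).N₃).sLo| + |pr.h| * |((k + 1 : ℕ) : ℤ) * pr.vα| +
          shearUnit nL pr.h) / nL).natAbs + 1)) ≤ r)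
    (hπMy : ∀ (a' : ℕ) (x : Site 2) (du : MDir) (j : ℕ) (pc : ℤ) (c' : V) (hI : du.1 = 1) (hyx : yx = false) (hs : du.2 = true) (hj : j < P.K) (yF : V)
      (hyF : pr.ψ φ w₀ yF = P.faceCen x du j) (hpc : pc = relφ φ w₀ yF (pr.bOf du.1))
      (h1 : pr.frame φ w₀ du.1 (pr.bOf du.1) c' ∈ Finset.Icc (loNV P x du j pc (aw du) - ((E : ℕ) : Site 2)) (hiNV P x du j pc (aw du) + ((E : ℕ) : Site 2)))
      (h2 : c' ∈ graphBall G w₀ ((concRadii2N P.toPCells2 gap gap' E₀ L' off).rE a' x du - r))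
      (hM : L' ≤ (concRadii2N P.toPCells2 gap gap' E₀ L' off).rM a' (x + stepVec du)) (hE : r ≤ (concRadii2N P.toPCells2 gap gap' E₀ L' off).rE a' x du),
      (∀ k ≤ (numsY a' x du j pc c' hI hyx hs hj yF hyF hpc h1 h2 hM hE).Nr, (numsY a' x du j pc c' hI hyx hs hj yF hyF hpc h1 h2 hM hE).RcL + Mq * (((((k + 1 : ℕ) : ℤ) * pr.vα).natAbs +
        (((shearUnit nL pr.h : ℤ) * |((k + 1 : ℕ) : ℤ) * (yPrmW nL ℓ' pr.h pr.vα R's qB' (numsY a' x du j pc c' hI hyx hs hj yF hyF hpc h1 h2 hM hE).Nr).sLo| + |pr.h| * |((k + 1 : ℕ) : ℤ) * pr.vα| +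
          shearUnit nL pr.h) / nL).natAbs + 1)) ≤ r) ∧
      (numsY a' x du j pc c' hI hyx hs hj yF hyF hpc h1 h2 hM hE).RcT + Mq * (((numsY a' x du j pc c' hI hyx hs hj yF hyF hpc h1 h2 hM hE).N₃ + 1) * shearUnit nL pr.h) ≤ r)
    (hπMyx : ∀ (a' : ℕ) (x : Site 2) (du : MDir) (j : ℕ) (pc : ℤ) (c' : V) (hI : du.1 = 1) (hyx : yx = true) (hs : du.2 = true) (hj : j < P.K) (yF : V)
      (hyF : pr.ψ φ w₀ yF = P.faceCen x du j) (hpc : pc = relφ φ w₀ yF (pr.bOf du.1))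
      (h1 : pr.frame φ w₀ du.1 (pr.bOf du.1) c' ∈ Finset.Icc (loNV P x du j pc (aw du) - ((E : ℕ) : Site 2)) (hiNV P x du j pc (aw du) + ((E : ℕ) : Site 2)))
      (h2 : c' ∈ graphBall G w₀ ((concRadii2N P.toPCells2 gap gap' E₀ L' off).rE a' x du - r))
      (hM : L' ≤ (concRadii2N P.toPCells2 gap gap' E₀ L' off).rM a' (x + stepVec du)) (hE : r ≤ (concRadii2N P.toPCells2 gap gap' E₀ L' off).rE a' x du),
      (numsYx a' x du j pc c' hI hyx hs hj yF hyF hpc h1 h2 hM hE).RcL + Mq * (((numsYx a' x du j pc c' hI hyx hs hj yF hyF hpc h1 h2 hM hE).Nr + 1) * shearUnit nL pr.h) ≤ r ∧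
      ∀ k ≤ (numsYx a' x du j pc c' hI hyx hs hj yF hyF hpc h1 h2 hM hE).N₃, (numsYx a' x du j pc c' hI hyx hs hj yF hyF hpc h1 h2 hM hE).RcT + Mq * (((((k + 1 : ℕ) : ℤ) * pr.vα).natAbs +
        (((shearUnit nL pr.h : ℤ) * |((k + 1 : ℕ) : ℤ) * (yPrmW nL ℓ' pr.h pr.vα R'₃ qB₃ (numsYx a' x du j pc c' hI hyx hs hj yF hyF hpc h1 h2 hM hE).N₃).sLo| + |pr.h| * |((k + 1 : ℕ) : ℤ) * pr.vα| +
          shearUnit nL pr.h) / nL).natAbs + 1)) ≤ r) :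
    ∀ (h : ProbeHistory V) (e : Site 2 × MDir),
      let Λ := concRadii2N P.toPCells2 gap gap' E₀ L' off
      let S : KSchA V ℕ := ⟨cellGeomSG₂bV G (pr.ψ φ w₀) P w₀ Λ b₀, q, δc⟩
      S.IsRun₂O G h → (S.astOf₂O G h).st.ochoice KSchA.qNE = some e → S.Valid₂O G h e →
      ∀ du ∈ S.onwardO G h (tgt e), ∀ j < P.K, ∀ o : Finset (Sym2 V), ∀ (yF : V) (pc : ℤ),
      pr.ψ φ w₀ yF = P.faceCen (tgt e) du j → pc = relφ φ w₀ yF (pr.bOf du.1) →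
      let a := S.aOf₁O G h e
      let a' := S.aOf₂O G h e
      let Q := faceStepWNbV G pr φ P w₀ Λ b₀ (pr.bOf du.1) a' (tgt e) du j pc (aw du) Rlev N M L' (S.Sx G h e a a' du)
      ∀ j' ∈ Finset.Icc Q.j₀ Q.j₁, ∃ (σ : KNLevels.SData V) (Sz : Finset V),
                                     KNLevels.SHyp (winLData G (pr.frame φ w₀ du.1 (pr.bOf du.1)) Q.root Q.Rπ Q.lo Q.hi Q.root Q.Sfin) j' σ ∧ σ.N ≤ Q.N ∧
                                     (1 - (S.p : ℝ) ^ σ.sB) ^ σ.k ≤ δ₂ ∧ Sz ⊆ stepRg G (pr.frame φ w₀ du.1 (pr.bOf du.1)) Q ∧ (∀ x ∈ σ.K, σ.face x ⊆ Sz) ∧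
                                     KNLevels.RelayClause (winLData G (pr.frame φ w₀ du.1 (pr.bOf du.1)) Q.root Q.Rπ Q.lo Q.hi Q.root Q.Sfin) (S.Wt G h e a a' du j o) j' σ Sz Q.T
                                       (stepRg G (pr.frame φ w₀ du.1 (pr.bOf du.1)) Q) δ₂ := by
  intro h e Λ S hrun hch hV du hdu j hj o yF pc hyF hpc a a' Q j' hj'
  -- ONE-SIDED: onward steps have positive sign
  have hs2 : du.2 = true := ((KSchA.mem_onwardO G S).1 hdu).2
  have hsg : sgOf du = 1 := by unfold sgOf; rw [hs2]; rfl
  -- the two maps and the frame facts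
  have hL0' : pr.c₀ * pr.L 0 ≤ pr.D := by omega
  have hL1' : pr.c₁ * pr.L 1 ≤ pr.D := by omega
  have hlipψ : Lip G (pr.ψ φ w₀) := pr.lip_ψ hlipφ w₀ hc₀.le hc₁.le hD hL0' hL1'
  have hws : WeakSteps G (pr.ψ φ w₀) := pr.weakSteps_ψ_q hqφ w₀ hc₀.le hc₁.le hD
  have hψ0 : pr.ψ φ w₀ w₀ = 0 := pr.ψ_base φ w₀ hD
  have hcI : 0 < pr.cOf du.1 := pr.cOf_pos hc₀ hc₁ du.1
  have hLI : pr.cOf du.1 * pr.L du.1 ≤ pr.D := pr.cOf_mul_L_le hL0' hL1' du.1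
  have hnz : pr.lvGen du.1 (pr.bOf du.1) ≠ 0 := pr.lvGen_bOf_ne_zero du.1 (pr.lvGen_ne_zero_of_detD_pos hDd hD du.1)
  have hb : |pr.lvGen du.1 (oth (pr.bOf du.1))| ≤ |pr.lvGen du.1 (pr.bOf du.1)| := pr.abs_lvGen_oth_bOf_le du.1
  have hσ : sgOf du = 1 ∨ sgOf du = -1 := sgOf_sign du
  have hbpar : (b₀ du.1 : ℤ) + 2 ≤ 5 * P.r du.1 := by
    have h1 : (b₀ du.1 : ℤ) ≤ 3 * P.r du.1 := by exact_mod_cast hb₀ du.1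
    have h2 : (1 : ℤ) ≤ P.r du.1 := by exact_mod_cast P.one_le_r du.1
    linarith
  have hbperp : (b₀ (oth du.1) : ℤ) + k₀ + 3 ≤ 5 * P.r (oth du.1) := by
    have h1 : (b₀ (oth du.1) : ℤ) ≤ 3 * P.r (oth du.1) := by exact_mod_cast hb₀ (oth du.1)
    linarith [hk₀' (oth du.1)]
  -- the schedule and the realised radii
  have hΛW : WFS2 P.toPCells2 Λ := concRadii2N_WFS2 P.toPCells2 gap gap' E₀ L' off hgap hE₀ hL'
  have hr : Realised (S.aOf₁O G h e) (S.aOf₂O G h e) (tgt e) := realised_of_choice_SG₂bV h hch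
  have hy : tgt e + stepVec du ≠ 0 := tgt_add_stepVec_ne_zero₂bV hψ0 hV hdu
  set g := nQ (S.aOf₁O G h e) (tgt e) with hg
  have hrM : Λ.rM a' (tgt e + stepVec du) = Erad gap gap' E₀ g + gap (Erad gap gap' E₀ g) - L' := by
    change Frad gap gap' E₀ (nQ (S.aOf₂O G h e) (tgt e + stepVec du)) - L' = _
    rw [hr.nQ_add_stepVec hy, Frad_succ]
  have hrE : Λ.rE a' (tgt e) du = Erad gap gap' E₀ g + gap (Erad gap gap' E₀ g) - 1 := by
    have h1 : nQ (S.aOf₂O G h e) (tgt e + stepVec du) = nS (S.aOf₂O G h e) (tgt e) + 1 := by rw [hr.nQ_add_stepVec hy, hr.nS_eq]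
    change (concRadii2N P.toPCells2 gap gap' E₀ L' off).rE (S.aOf₂O G h e) (tgt e) du = _
    rw [concRadii2N_rE_eq P.toPCells2 gap gap' E₀ L' off h1, hr.nS_eq, Frad_succ]
  have hgapg := hgapR (Erad gap gap' E₀ g)
  have hR : PA.r₀ ≤ Λ.rE a' (tgt e) du := by rw [hrE]; omega
  have hrim : Λ.rM a' (tgt e + stepVec du) - L' + PA.r₀ ≤ Λ.rE a' (tgt e) du := by rw [hrM, hrE]; omega
  have hrE' : r ≤ Λ.rE a' (tgt e) du := le_trans (by omega) hR
  have hL'M : L' ≤ Λ.rM a' (tgt e + stepVec du) := by rw [hrM]; omega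
  have hj'M : M + 1 ≤ j' := (Finset.mem_Icc.1 hj').1
  have hj'R : j' ≤ Rlev := (Finset.mem_Icc.1 hj').2
  -- the subbox fact, the law off the graph
  have hWD : KNLevels.IsSubbox (winGraph G Q.root Q.Rπ) (S.Wt G h e a a' du j o) S.p (stepRg G (pr.frame φ w₀ du.1 (pr.bOf du.1)) Q) :=
    isSubbox_faceStepWNbV hΛW hb₀ hV hdu pc (aw du) Rlev N M L' hlipψ hws hj
  have hWG : ∀ e', e' ∉ G.edgeSet → S.Wt G h e a a' du j o e' = 0 := fun e' he => KNCells.KSchA.Wt_eq_zero_of_not_mem_edgeSet he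
  -- the planar diameter of the step region (D2): `stepRg ⊆ Win ψ (farASS₂) ⊆ E^far`, whose `φ`-diameter is `m` by `hdiam`
  have hAm := pr.A_mul_modulus_ne_zero hDd hD
  have hDm : ∀ d ∈ stepRg G (pr.frame φ w₀ du.1 (pr.bOf du.1)) Q, ∀ d' ∈ stepRg G (pr.frame φ w₀ du.1 (pr.bOf du.1)) Q, φ d - φ d' ∈ box 2 m := by
    intro d hd d' hd'
    have hSW := stepRgNb_subset_WinV G pr φ P w₀ Λ b₀ (pr.bOf du.1) a' (tgt e) du j pc (aw du) Rlev N M L' (S.Sx G h e a a' du)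
    have hEf := Win_farAS₂_subset_Efar_bV P w₀ b₀ hlipψ hws (le_trans (by omega) (hΛW.ρE1 a' (tgt e) du 0)) j
    exact hdiam_fine_bV (a' := a') hAm hc₀ hc₁ hD hdiam (tgt e) du d (hEf (hSW hd)) d' (hEf (hSW hd'))
  -- the near reading on the face's axes, from the two lattice functionals (L-F2)
  have hI2 : du.1 = 0 ∨ du.1 = 1 := by rcases du with ⟨I, s⟩; fin_cases I <;> simp
  have hnear₂' : ∀ c' w, |pr.vβ * (φ w 0 - φ c' 0) - pr.vα * (φ w 1 - φ c' 1)| ≤ Λ₀ → |(nL : ℤ) * (φ w 1 - φ c' 1) - pr.h * (φ w 0 - φ c' 0)| ≤ Λ₁ →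
      |fineSkel φ c' pr.A nL pr.h pr.vα pr.vβ pr.c₀ pr.c₁ (pr.D / 2) (pr.D / 2) pr.D w du.1| ≤ kA du.1 ∧
        |fineSkel φ c' pr.A nL pr.h pr.vα pr.vβ pr.c₀ pr.c₁ (pr.D / 2) (pr.D / 2) pr.D w (oth du.1)| ≤ kA (oth du.1) := fun c' w h0 h1 => by
    obtain ⟨k0, k1⟩ := abs_fineSkel_le_of_lam₂ (φ := φ) c' hD hc₀.le hc₁.le hkA0 hkA1 h0 h1
    rcases hI2 with hI | hI
    · rw [hI]; exact ⟨k0, k1⟩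
    · rw [hI]; exact ⟨k1, k0⟩
  -- THE ROUTE at every centre, by the face's axis
  have hroute : ∀ c', pr.frame φ w₀ du.1 (pr.bOf du.1) c' ∈
        Finset.Icc (loNV P (tgt e) du j pc (aw du) - ((E : ℕ) : Site 2)) (hiNV P (tgt e) du j pc (aw du) + ((E : ℕ) : Site 2)) →
      c' ∈ graphBall G w₀ (Λ.rE a' (tgt e) du - r) →
      ∃ Qt Ft : Finset V, Ft ⊆ Q.T ∧ Qt ⊆ stepRg G (pr.frame φ w₀ du.1 (pr.bOf du.1)) Q ∧
        1 - δ₂ ^ 3 ≤ (prodBernoulli (S.Wt G h e a a' du j o)).real (linkIn (↑Qt : Set V) (Λc c' kz) Ft) := by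
    rcases hI2 with hI | hI
    · exact hroute_of_faceRunNums_x6FVCQ hlipφ hqφ hΔg pr w₀ du (pr.bOf du.1) hc₀ hc₁ hD hL0' hL1' hA0 hnz hnL hvL hmf P Λ b₀ a'
        (tgt e) j pc (aw du) Rlev N M L' (S.Sx G h e a a' du) (hk₀ du.1) (by omega) hbpar hbperp hrE' hWG hWD hσ B hB hκL ℓ' R's qB Rl R'₃ qB₃
        hlay Rlev₁ N₁ j₀₁ j₁₁ Rlev₂ N₂ j₀₂ j₁₂ Rlev₃ N₃' j₀₃ j₁₃ hRl₁ hRl₂ hRl₃ hj₁ hj₂ hj₃ (by rw [hsg]; exact hB0) hRlr (by rw [hsg]; exact hΛR) hΛQ0 hΛQ1 hΛZ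
        hnear₂' hkbMz hπ1 hclr₁ hδ hδ1 nF hchain hcount₁ hcount₂ hcount₃ hη Pb Pr hPNb hAb hdDb hDρb hKCmaxb hwideb
        hdwb hDwb hT'b hr₀b hRb₀ hrsb hcSb hEb hreachb hr₁ hr₁R hPNr hAr hdDr hDρr hKCmaxr hwider
        hdwr hDwr hwidey hdwy hDwy hT'r hr₀r hRr₀ hrsr hcSr hEr hEy hreachr hr₂ hr₂R Rg hRg hRgcard hcU1 Λc kz hΛ
        hclrz hcz hzconn hRsr hZρ hρr hZU Qb Fb (by rw [hsg]; exact hQb) (by rw [hsg]; exact hFb) kk₁ kk₂ kk₃ hkN₁ hkN₂ hkN₃ hk₁ hk₂ hk₃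
        hbridge (fun c' τ hτ => by rw [hsg]; exact hlongx c' τ hτ) hlongy hDm hR₁ hR₁b hR₁r
        (fun c' h1 h2 => numsX a' (tgt e) du j pc c' hI hs2 hj yF hyF hpc h1 h2 hL'M hrE') (fun c' h1 h2 => hnFx a' (tgt e) du j pc c' hI hs2 hj yF hyF hpc h1 h2 hL'M hrE')
        (fun c' h1 h2 => hσTx a' (tgt e) du j pc c' hI hs2 hj yF hyF hpc h1 h2 hL'M hrE')
        (fun c' h1 h2 => (hπMx a' (tgt e) du j pc c' hI hs2 hj yF hyF hpc h1 h2 hL'M hrE').1)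
        (fun c' h1 h2 => (hπMx a' (tgt e) du j pc c' hI hs2 hj yF hyF hpc h1 h2 hL'M hrE').2)
    · -- y′-face: the Y4 record (v_L ≥ 0) or, under the node bit `yx`, the X4-shaped record via the du-generic x6F composition ((R-49)(c2b))
      cases hyx : yx
      · exact hroute_of_faceRunNums_y6FVCQ hlipφ hqφ hΔg pr w₀ du (pr.bOf du.1) hc₀ hc₁ hD hL0' hL1' hA0 hnz hnL hvL hmf P Λ b₀ a'
          (tgt e) j pc (aw du) Rlev N M L' (S.Sx G h e a a' du) (hk₀ du.1) (by omega) hbpar hbperp hrE' hWG hWD hσ B hB hκL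
          ℓ' R's qB' Rl R'₃ qB₃' hlay Rlev₁ N₁ j₀₁ j₁₁ Rlev₂ N₂ j₀₂ j₁₂ Rlev₃ N₃' j₀₃ j₁₃ hRl₁ hRl₂ hRl₃ hj₁ hj₂ hj₃ hB0 hRlr hΛR hΛQ0 hΛQ1
          hΛZ hnear₂' hkbMz hπ1 hclr₁ hδ hδ1 nF hchain hcount₁ hcount₂ hcount₃ hη Pb Pr hPNb hAb hdDb hDρb hKCmaxb
          hwideb hdwb hDwb hT'b hr₀b hRb₀ hrsb hcSb hEb hreachb hr₁ hr₁R hPNr hAr hdDr hDρr hKCmaxr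
          hwiderY hdwrY hDwrY hwideyY hdwyY hDwyY hT'r hr₀r hRr₀ hrsr hcSr hEr hEy hreachr hr₂ hr₂R Rg hRg hRgcard hcU1 Λc
          kz hΛ hclrz hcz hzconn hRsr hZρ hρr hZU Qb Fb hQb hFb kk₁ kk₂ kk₃ hkN₁ hkN₂ hkN₃ hk₁ hk₂
          hk₃ hbridge hlongx (fun c' τ hτ => by rw [hsg]; exact hlongy c' τ hτ) hDm hR₁ hR₁b hR₁r
          (fun c' h1 h2 => numsY a' (tgt e) du j pc c' hI hyx hs2 hj yF hyF hpc h1 h2 hL'M hrE') (fun c' h1 h2 => hnFy a' (tgt e) du j pc c' hI hyx hs2 hj yF hyF hpc h1 h2 hL'M hrE')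
          (fun c' h1 h2 => hσTy a' (tgt e) du j pc c' hI hyx hs2 hj yF hyF hpc h1 h2 hL'M hrE')
          (fun c' h1 h2 => (hπMy a' (tgt e) du j pc c' hI hyx hs2 hj yF hyF hpc h1 h2 hL'M hrE').1)
          (fun c' h1 h2 => (hπMy a' (tgt e) du j pc c' hI hyx hs2 hj yF hyF hpc h1 h2 hL'M hrE').2)
      · exact hroute_of_faceRunNums_x6FVCQ hlipφ hqφ hΔg pr w₀ du (pr.bOf du.1) hc₀ hc₁ hD hL0' hL1' hA0 hnz hnL hvL hmf P Λ b₀ a'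
          (tgt e) j pc (aw du) Rlev N M L' (S.Sx G h e a a' du) (hk₀ du.1) (by omega) hbpar hbperp hrE' hWG hWD hσ B hB hκL ℓ' R's qB Rl R'₃ qB₃
          hlay Rlev₁ N₁ j₀₁ j₁₁ Rlev₂ N₂ j₀₂ j₁₂ Rlev₃ N₃' j₀₃ j₁₃ hRl₁ hRl₂ hRl₃ hj₁ hj₂ hj₃ (by rw [hsg]; exact hB0) hRlr (by rw [hsg]; exact hΛR) hΛQ0 hΛQ1 hΛZ
          hnear₂' hkbMz hπ1 hclr₁ hδ hδ1 nF hchain hcount₁ hcount₂ hcount₃ hη Pb Pr hPNb hAb hdDb hDρb hKCmaxb hwideb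
          hdwb hDwb hT'b hr₀b hRb₀ hrsb hcSb hEb hreachb hr₁ hr₁R hPNr hAr hdDr hDρr hKCmaxr hwider
          hdwr hDwr hwidey hdwy hDwy hT'r hr₀r hRr₀ hrsr hcSr hEr hEy hreachr hr₂ hr₂R Rg hRg hRgcard hcU1 Λc kz hΛ
          hclrz hcz hzconn hRsr hZρ hρr hZU Qb Fb (by rw [hsg]; exact hQb) (by rw [hsg]; exact hFb) kk₁ kk₂ kk₃ hkN₁ hkN₂ hkN₃ hk₁ hk₂ hk₃
          hbridge (fun c' τ hτ => by rw [hsg]; exact hlongx c' τ hτ) hlongy hDm hR₁ hR₁b hR₁r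
          (fun c' h1 h2 => numsYx a' (tgt e) du j pc c' hI hyx hs2 hj yF hyF hpc h1 h2 hL'M hrE') (fun c' h1 h2 => hnFyx a' (tgt e) du j pc c' hI hyx hs2 hj yF hyF hpc h1 h2 hL'M hrE')
          (fun c' h1 h2 => hσTyx a' (tgt e) du j pc c' hI hyx hs2 hj yF hyF hpc h1 h2 hL'M hrE')
          (fun c' h1 h2 => (hπMyx a' (tgt e) du j pc c' hI hyx hs2 hj yF hyF hpc h1 h2 hL'M hrE').1)
          (fun c' h1 h2 => (hπMyx a' (tgt e) du j pc c' hI hyx hs2 hj yF hyF hpc h1 h2 hL'M hrE').2)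
  -- assemble ((S0) forced kit)
  exact hkits_faceStepWNbFVCQ hlipφ hqφ hΔg hδ₂ pr w₀ du (pr.bOf du.1) hc₀ hc₁ hD hL0' hL1' hA0 hb hnz (hnC du.1) (hU3 du.1) P Λ b₀ a'
    (tgt e) j pc (aw du) Rlev N M L' (S.Sx G h e a a' du) hyF hpc (by omega) (hRlev du.1) (hRlev' du) (hroomF du) (hkF du.1) hj'M
    hj'R PA hPN hA hdD hDρ hKCmax hMtan hMd hMD hT' hr₀ hR hrs hcS hE hreach hrim Rg hRg hRgcard hcU1 Λc kz (fun c v hv => (hΛ c v hv).1)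
    hzconn hcz kk hN hk hroute

end Skelφ

end Summit.CriticalPhenomena.PercolationContinuityZ3.Theorems.Transplant

end
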